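import Summits.QuantumFields.BalabanUV.T4Continuum.Support.NE7SliceLetterHomFlatWitness
import Summits.QuantumFields.BalabanUV.T4Continuum.Support.SkeletonLattice
import HarnessLib

/-!
# NE7CombLetterFlatWitness — THE ONE REMAINING LETTER (c₁)^{comb} OF THE END OF RECORD (`NE7ApeCurvedRepRoadBCombEnd`, F145) IS INHABITED IN THE ASSEMBLER's CURRENCY AT THE FLAT
# BACKGROUND: for `d ≥ 2`, `L ≥ 2` there is `K ≥ 0` (free of `N`, `j`) with which, at `W = flatCfg`, the homogeneous two-term letter on the block-comb slice holds ONE-TERM,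
# `(K_G, K_X) = (K·L^{j+1}, 0)` — (152) read on the comb slice (file 77 of the curved (APE))

Cell `pub-balaban`, rung (B)+1 sub-cell t4, lineage `b2b-balaban-t4-ne7-p1` (CRUX PROVER NE7 #1 = OWNER of row NE7), generation 81; memo `t4/b2b-balaban-t4-ne7-p1-g81/COMB-SLICE.md` §5.
File F147, over F138 `NE7SliceLetterHomFlatWitness.homSliceLetter_flatCfg` ((152) = lineage #2's `NE7FlatSliceEnd.sliceSolver_end_holds` in the homogeneous shape) BY NAME: the comb
slice is a SUBSET of the skew tangent fields, so the flat one-term theorem restricts to it verbatim; the comb-vanishing hypothesis is not even used.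
WHY.  F145 displays ONE analytic letter `hGcomb` with free constants `(K_G, K_X)`; memo §2 expects it ONE-TERM (`K_X = 0`, `K_G ≲ K·M`) at non-degenerate backgrounds.  THIS file
certifies that shape and currency at the trivial background, so F145's hypothesis set is jointly satisfiable there in the closing currency (the curved letter is B9 §3 material).
WHAT ([folklore]; 0 def, 0 sorry).  **`combLetter_flatCfg`** — `∃ K ≥ 0, ∀ N ≥ 1, j`: F145's `hGcomb` at `W = flatCfg` with `KG = K·L^{j+1}`, `KX = 0`.
HONEST FRAMING (page 1): shape bookkeeping over a landed theorem; nothing new at curved data; nothing of Bałaban's asserted beyond what (152) cites; NOT ONE-STEP, NOT NE7; spine 0∕9;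
finite T⁴ rung (B)+1 — NOT infinite volume, NOT mass gap, NOT `BetaPertH`, NOT Clay.  Continuum YM on T⁴ ⇐ BetaPertH ∧ nine spine estimates (0/9 proved); BetaPertH ⇐ (D1) ∧ (D4) ∧
CAP+tail; G-an2-4 gates asym, D1 and NE2/3/4.
-/

set_option autoImplicit false

open scoped BigOperators Matrix Matrix.Norms.L2Operator
open NormedSpace Finset

namespace Summit.QuantumFields.BalabanUV.T4Continuum.NE7CombLetterFlatWitness

open Literature.MathematicalPhysics.QuantumFieldTheory.Balaban1983to89
open B7Prop1Explicit B7Prop2Explicit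
open T4AveragingDeficitWall (IsSkewDir curlAt dirL1)
open T4AveragingDeficitWallBoundary (periodBox)
open AveragingDeficitPeriodicCounting (IsPeriodicDir)
open MinimalActionLevels (perWin)
open MinimalActionWitness (flatCfg)
open NE3HessForm (hess)
open NE3TangentCovariantTower (dirIter)
open SkeletonLattice (cmod)
open NE7SliceLetterHomFlatWitness (homSliceLetter_flatCfg)

noncomputable section

variable {d : ℕ} {n : Type} [Fintype n] [DecidableEq n]

/-- **(c₁)^{comb} AT THE FLAT BACKGROUND, ONE-TERM, IN CURRENCY**: for `d ≥ 2`, `L ≥ 2` there is `K ≥ 0` (free of `N`, `j`) such that for every `N ≥ 1`, `j`, F145's letter `hGcomb` holds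
at `W = flatCfg` with `(K_G, K_X) = (K·L^{j+1}, 0)`: for every skew `X` vanishing on the in-block comb bonds, `(N·L^{j+1})`-periodic and flat-tangent, every sup bound `R`, every
`g ≥ 0` bounding its flat slice functional, `‖curlAt flatCfg X z μ′ ν′‖ ≤ (K·L^{j+1})·g + 0·R`. [cite: Balaban1984PropagatorsI, (1.103) p.34, (1.115) p.36] -/
theorem combLetter_flatCfg [Nonempty n] (hd : 2 ≤ d) {L : ℕ} (hL : 2 ≤ L) :
    ∃ K : ℝ, 0 ≤ K ∧ ∀ (N : ℕ) [NeZero N] (j : ℕ),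
      ∀ X : Site d → Fin d → Matrix n n ℂ, IsSkewDir X →
        (∀ (z : Site d) (μ : Fin d), (∀ κ, κ < μ → cmod (L ^ (j + 1)) z κ = 0) → cmod (L ^ (j + 1)) z μ + 1 < ((L ^ (j + 1) : ℕ) : ℤ) → X z μ = 0) →
        IsPeriodicDir X ((N * L ^ (j + 1) : ℕ) : ℤ) → dirIter L (j + 1) (flatCfg : Site d → Fin d → (Matrix n n ℂ)ˣ) X = 0 →
        ∀ R : ℝ, (∀ y κ', ‖X y κ'‖ ≤ R) → ∀ g : ℝ, 0 ≤ g →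
        (∀ Y : Site d → Fin d → Matrix n n ℂ, IsSkewDir Y → IsPeriodicDir Y ((N * L ^ (j + 1) : ℕ) : ℤ) →
          dirIter L (j + 1) (flatCfg : Site d → Fin d → (Matrix n n ℂ)ˣ) Y = 0 →
          |hess (flatCfg : Site d → Fin d → (Matrix n n ℂ)ˣ) X Y (perWin d (N * L ^ (j + 1)))| ≤ g * dirL1 Y (periodBox (d := d) (N * L ^ (j + 1)))) →
        ∀ (z : Site d) (μ' ν' : Fin d), μ' ≠ ν' →
          ‖curlAt (flatCfg : Site d → Fin d → (Matrix n n ℂ)ˣ) X z μ' ν'‖ ≤ (K * (L : ℝ) ^ (j + 1)) * g + 0 * R := by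
  obtain ⟨K, hK, h⟩ := homSliceLetter_flatCfg (n := n) hd hL
  exact ⟨K, hK, fun N _ j X hX _ hXP hX0 R hR g hg hH z μ' ν' hne => h N j X hX hXP hX0 R hR g hg hH z μ' ν' hne⟩

end

end Summit.QuantumFields.BalabanUV.T4Continuum.NE7CombLetterFlatWitness
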